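import Summits.NavierStokesRegularity.NavierStokesRegularity.Theorems.HubbleDynamoNoSelfExcitedDynamoStubEnstrophyEvolution
import Summits.NavierStokesRegularity.NavierStokesRegularity.Theorems.HubbleDynamoNoSelfExcitedDynamoStubEnstrophyBalance
import Summits.NavierStokesRegularity.NavierStokesRegularity.Theorems.HubbleDynamoNoSelfExcitedDynamoStubDivCurlProfile
import Summits.NavierStokesRegularity.NavierStokesRegularity.Theorems.HubbleDynamoNoSelfExcitedDynamoStubBackwardGronwall
import Summits.NavierStokesRegularity.NavierStokesRegularity.Theorems.HubbleDynamoNoSelfExcitedDynamoStubCurlFreeLiouville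
import Summits.NavierStokesRegularity.NavierStokesRegularity.Theorems.HubbleDynamoNoSelfExcitedDynamoBackusRegime
import Literature.Analysis.FluidPDE.LambFormCurlKernel
import Literature.Analysis.FluidPDE.AncientSimilarityVorticity
import Literature.Analysis.FluidPDE.LeiZhang2011Proofs
import HarnessLib

/-!
# Crux `NoSelfExcitedDynamo` (stmt-NavierStokesRegularity-1934), line `registered` (v19):
# the Beltrami-depletion regime, stub `stub_beltramiRegime`

Theorems file (lands `--supports stmt-NavierStokesRegularity-1934`). For an ETERNAL classical
solution `(W, Q)` of Leray's backward system `∂ₛW + ½W + ½(y·∇)W + (W·∇)W + ∇Q = ΔW`, `div W = 0`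
on `ℝ × ℝ³` (`IsBackwardLeraySolutionOn univ 1 W Q`) in the uniform profile class
`(1 + ‖y‖)^{k+1}‖DᵏW(s)‖ ≤ K_k`, write `Ω = curl W` and decompose `curl Ω` into its part along
`Ω` and the part `(curl Ω)⊥` orthogonal to `Ω`. If the amplitude is `‖W‖ ≤ K` and on every slice
the non-Beltrami part is depleted, `∫ |(curl Ω)⊥|² ≤ β ∫ |curl Ω|²` with `0 ≤ β`, `βK² < 1`, then
`W ≡ 0` (`stub_beltramiRegime`). With `β = 1` this is exactly the landed Backus regime
`stub_backusRegime` (`‖W‖ < 1`).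

## Proof

On one slice `V = W(s)` (smooth, divergence free, profile decay) the stretching integral has the
Lamb form `S = ∫⟪Ω, (DV)Ω⟫ = ∫⟪V × Ω, curl Ω⟫` (`beltrami_stretch_eq`): the fluxes `⟪V,Ω⟫Ω` and
`½|Ω|²V` have zero total divergence (`PineauVicol2026.integral_divergence_eq_zero_of_integrable_div`,
`div Ω = div V = 0`), so `S = −∫⟪V, (DΩ)Ω⟫` and `(DΩ)Ω = (curl Ω) × Ω + ∇(½|Ω|²)`
(`convect_self_eq_cross_curl_add_gradient`). Since `V × Ω ⟂ Ω`, only `(curl Ω)⊥` is seen: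
pointwise `⟪V × Ω, curl Ω⟫ ≤ K|Ω| |(curl Ω)⊥| ≤ (θK²/4)|Ω|² + θ⁻¹|(curl Ω)⊥|²`
(`beltrami_pointwise`, `|(curl Ω)⊥|² = |curl Ω|² − ⟪curl Ω, Ω⟫²/|Ω|²`). With `θ ≥ β`, `θ > 0`,
`θK² < 1` and the div–curl identity `∫|DΩ|²_F = ∫|curl Ω|²` (`stub_divCurlProfile` for `Ω`) the
slice inequality `S − D_F − ¼E ≤ −¼(1 − θK²)E` follows (`beltrami_slice_le`); the enstrophy
identity `E(s₁) − E(s₀) = 2∫(S − D_F − ¼E)` (`stub_enstrophyEvolution`), the backward Grönwall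
lemma (`stub_backwardGronwall`) and the curl-free Liouville theorem (`stub_curlFreeLiouville`)
finish exactly as in `strainRegime_quarter` / `stub_backusRegime`.
-/

noncomputable section

-- the mandated stub namespace repeats `NavierStokesRegularity` (tree precedent for this crux's stubs)
set_option linter.dupNamespace false

namespace Summit.NavierStokesRegularity.NavierStokesRegularity.Theorems.NoSelfExcitedDynamo.Registered

open Set MeasureTheory Filter Topology InnerProductSpace Function
open scoped RealInnerProductSpace NNReal ENNReal ContDiff Laplacian
open Literature.Analysis.FluidPDE

/-! ### Pointwise algebra of the cross product -/

/-- **Pointwise Beltrami depletion.** For `‖w‖ ≤ K` and `θ > 0`: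
`⟪w × Ω, C⟫ ≤ (θK²/4)‖Ω‖² + θ⁻¹(‖C‖² − ⟪C, Ω⟫²/‖Ω‖²)`. Indeed `w × Ω ⟂ Ω`, so only
`C⊥ = C − (⟪C,Ω⟫/‖Ω‖²)Ω` is seen, `⟪w × Ω, C⟫ = ⟪w × Ω, C⊥⟫ ≤ K‖Ω‖‖C⊥‖`, and
`‖C⊥‖² = ‖C‖² − ⟪C,Ω⟫²/‖Ω‖²` (Pythagoras, `‖w × Ω‖ ≤ ‖w‖‖Ω‖` is the tree's
`norm_cross_le_norm_mul_norm`); weighted Young finishes (for `Ω = 0` both `w × Ω` and the junk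
value `⟪C,0⟫²/0 = 0` vanish). -/
theorem beltrami_pointwise (w Ω C : EuclideanSpace ℝ (Fin 3)) {K θ : ℝ} (hw : ‖w‖ ≤ K) (hθ : 0 < θ) :
    ⟪cross w Ω, C⟫ ≤ θ * K ^ 2 / 4 * ‖Ω‖ ^ 2 + θ⁻¹ * (‖C‖ ^ 2 - ⟪C, Ω⟫ ^ 2 / ‖Ω‖ ^ 2) := by
  by_cases hΩ : Ω = 0
  · subst hΩ
    have h0 : cross w 0 = 0 := by simp [cross]
    simp only [h0, inner_zero_left, norm_zero, inner_zero_right]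
    norm_num
    positivity
  -- `w × Ω ⟂ Ω`
  have hperp : ⟪cross w Ω, Ω⟫ = 0 := by
    rw [inner_cross_left_eq_neg]
    have : cross Ω Ω = 0 := by simp [cross]
    rw [this, inner_zero_right, neg_zero]
  set P : EuclideanSpace ℝ (Fin 3) := C - (⟪C, Ω⟫ / ‖Ω‖ ^ 2) • Ω with hP
  have hΩ0 : 0 < ‖Ω‖ := norm_pos_iff.2 hΩ
  have h1 : ⟪cross w Ω, C⟫ = ⟪cross w Ω, P⟫ := by
    rw [hP, inner_sub_right, inner_smul_right, hperp, mul_zero, sub_zero]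
  have h2 : ‖P‖ ^ 2 = ‖C‖ ^ 2 - ⟪C, Ω⟫ ^ 2 / ‖Ω‖ ^ 2 := by
    rw [hP, norm_sub_sq_real, inner_smul_right, norm_smul, mul_pow, Real.norm_eq_abs, sq_abs]
    field_simp
    ring
  have h3 : ⟪cross w Ω, P⟫ ≤ K * ‖Ω‖ * ‖P‖ := by
    calc ⟪cross w Ω, P⟫ ≤ ‖cross w Ω‖ * ‖P‖ := real_inner_le_norm _ _
      _ ≤ ‖w‖ * ‖Ω‖ * ‖P‖ := by gcongr; exact norm_cross_le_norm_mul_norm w Ω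
      _ ≤ K * ‖Ω‖ * ‖P‖ := by gcongr
  have h4 : K * ‖Ω‖ * ‖P‖ ≤ θ * K ^ 2 / 4 * ‖Ω‖ ^ 2 + θ⁻¹ * ‖P‖ ^ 2 := by
    have e : θ * K ^ 2 / 4 * ‖Ω‖ ^ 2 + θ⁻¹ * ‖P‖ ^ 2 - K * ‖Ω‖ * ‖P‖ =
        θ⁻¹ * (θ * K * ‖Ω‖ / 2 - ‖P‖) ^ 2 := by
      field_simp
      ring
    have : 0 ≤ θ⁻¹ * (θ * K * ‖Ω‖ / 2 - ‖P‖) ^ 2 := by positivity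
    linarith
  rw [h1, ← h2]
  exact h3.trans h4

/-! ### The stretching integral in Lamb form -/

/-- **The stretching integral in Lamb form.** For `V ∈ C³(ℝ³; ℝ³)` divergence free in the
profile class (one constant `L` for `(1+|y|)|V|`, `(1+|y|)²‖DV‖`, `(1+|y|)³‖DΩ‖`, `(1+|y|)⁴|ΔΩ|`,
`Ω = curl V`), the density `⟪V × Ω, curl Ω⟫` is integrable and
`∫⟪Ω, (DV)Ω⟫ = ∫⟪V × Ω, curl Ω⟫`: the flux `⟪V,Ω⟫Ω` gives `∫⟪Ω,(DV)Ω⟫ = −∫⟪V,(DΩ)Ω⟫`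
(`div Ω = 0`), the Lamb form `(DΩ)Ω = (curl Ω) × Ω + ∇(½|Ω|²)`
(`convect_self_eq_cross_curl_add_gradient`), the Bernoulli flux `½|Ω|²V` gives
`∫⟪V, ∇(½|Ω|²)⟫ = 0` (`div V = 0`), and `⟪V, (curl Ω) × Ω⟫ = −⟪V × Ω, curl Ω⟫`; both fluxes are
`O((1+|y|)⁻⁵)` with integrable divergence, so
`PineauVicol2026.integral_divergence_eq_zero_of_integrable_div` applies. -/
theorem beltrami_stretch_eq {V : EuclideanSpace ℝ (Fin 3) → EuclideanSpace ℝ (Fin 3)} (hV3 : ContDiff ℝ 3 V)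
    (hdiv : VectorCalculus.IsDivFree V) {L : ℝ} (hL0 : 0 ≤ L)
    (hL : ∀ y, (1 + ‖y‖) * ‖V y‖ ≤ L ∧ (1 + ‖y‖) ^ 2 * ‖fderiv ℝ V y‖ ≤ L ∧
      (1 + ‖y‖) ^ 3 * ‖fderiv ℝ (curl V) y‖ ≤ L ∧ (1 + ‖y‖) ^ 4 * ‖(Δ (curl V)) y‖ ≤ L) :
    Integrable (fun y => ⟪cross (V y) (curl V y), curl (curl V) y⟫) ∧
    ∫ y, ⟪curl V y, fderiv ℝ V y (curl V y)⟫ = ∫ y, ⟪cross (V y) (curl V y), curl (curl V) y⟫ := by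
  obtain ⟨i1, -, i3, i4, -, -, hVb, -⟩ := enstrophy_slice_integrable hV3 hL0 hL
  have hV2 : ContDiff ℝ 2 V := hV3.of_le (by norm_cast)
  have hV1 : ContDiff ℝ 1 V := hV3.of_le (by norm_cast)
  have hΩ2 : ContDiff ℝ 2 (curl V) := PineauVicol2026.contDiff_two_curl hV3
  have hΩ1 : ContDiff ℝ 1 (curl V) := hΩ2.of_le one_le_two
  have hVd : ∀ y, DifferentiableAt ℝ V y := fun y => hV1.differentiable one_ne_zero y
  have hΩd : ∀ y, DifferentiableAt ℝ (curl V) y := fun y => hΩ1.differentiable one_ne_zero y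
  have cDΩ : Continuous (fderiv ℝ (curl V)) := hΩ1.continuous_fderiv one_ne_zero
  have hdiv' : ∀ y, VectorCalculus.divergence V y = 0 := hdiv
  -- `|Ω| ‖DΩ‖` is integrable
  have hΩD : Integrable fun y => ‖curl V y‖ * ‖fderiv ℝ (curl V) y‖ :=
    i4.mono' (hΩ1.continuous.norm.mul cDΩ.norm).aestronglyMeasurable
      (Eventually.of_forall fun y => by
        rw [Real.norm_of_nonneg (by positivity)]
        exact le_mul_of_one_le_left (by positivity) (by linarith [norm_nonneg y]))
  -- (A) the flux `⟪V,Ω⟩Ω`: `∫⟪V,(DΩ)Ω⟫ + ∫⟪Ω,(DV)Ω⟫ = 0`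
  have hθ : ContDiff ℝ 1 fun y => ⟪V y, curl V y⟫ := hV1.inner ℝ hΩ1
  have hF1 : ContDiff ℝ 1 fun y => ⟪V y, curl V y⟫ • curl V y := hθ.smul hΩ1
  have hdivF : ∀ y, VectorCalculus.divergence (fun z => ⟪V z, curl V z⟫ • curl V z) y =
      ⟪V y, fderiv ℝ (curl V) y (curl V y)⟫ + ⟪curl V y, fderiv ℝ V y (curl V y)⟫ := by
    intro y
    rw [divergence_smul_apply (hθ.differentiable one_ne_zero y) (hΩd y), divergence_curl_eq_zero_holds V hV2 y,
      mul_zero, zero_add, gradient, real_inner_comm, InnerProductSpace.toDual_symm_apply,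
      fderiv_inner_apply ℝ (hVd y) (hΩd y), real_inner_comm (curl V y) (fderiv ℝ V y (curl V y))]
  have hpt : ∀ y, |⟪V y, fderiv ℝ (curl V) y (curl V y)⟫| ≤ L * (‖curl V y‖ * ‖fderiv ℝ (curl V) y‖) :=
    fun y => calc
      |⟪V y, fderiv ℝ (curl V) y (curl V y)⟫| ≤ ‖V y‖ * ‖fderiv ℝ (curl V) y (curl V y)‖ := abs_real_inner_le_norm _ _
      _ ≤ L * (‖fderiv ℝ (curl V) y‖ * ‖curl V y‖) :=
          mul_le_mul (hVb y) ((fderiv ℝ (curl V) y).le_opNorm _) (norm_nonneg _) hL0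
      _ = L * (‖curl V y‖ * ‖fderiv ℝ (curl V) y‖) := by ring
  have hI : Integrable fun y => ⟪V y, fderiv ℝ (curl V) y (curl V y)⟫ :=
    (hΩD.const_mul L).mono' (hV1.continuous.inner (cDΩ.clm_apply hΩ1.continuous)).aestronglyMeasurable
      (Eventually.of_forall fun y => by rw [Real.norm_eq_abs]; exact hpt y)
  have hFi : Integrable fun y => ‖⟪V y, curl V y⟫ • curl V y‖ / (1 + ‖y‖) := by
    refine (i1.const_mul L).mono' ?_ (Eventually.of_forall fun y => ?_)
    · exact (hF1.continuous.norm.div (continuous_const.add continuous_norm)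
        fun y => (by positivity : (0 : ℝ) < 1 + ‖y‖).ne').aestronglyMeasurable
    · rw [Real.norm_of_nonneg (by positivity), norm_smul]
      refine (div_le_self (by positivity) (by linarith [norm_nonneg y])).trans ?_
      calc ‖⟪V y, curl V y⟫‖ * ‖curl V y‖ ≤ ‖V y‖ * ‖curl V y‖ * ‖curl V y‖ :=
            mul_le_mul_of_nonneg_right (norm_inner_le_norm _ _) (norm_nonneg _)
        _ ≤ L * ‖curl V y‖ * ‖curl V y‖ := by gcongr; exact hVb y
        _ = L * ‖curl V y‖ ^ 2 := by ring
  have hdi : Integrable fun y => VectorCalculus.divergence (fun z => ⟪V z, curl V z⟫ • curl V z) y := by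
    simp_rw [hdivF]; exact hI.add i3
  have hA := PineauVicol2026.integral_divergence_eq_zero_of_integrable_div hF1 hFi hdi
  simp_rw [hdivF] at hA
  rw [integral_add hI i3] at hA
  -- (B) the Bernoulli flux `½|Ω|² V`: `∫⟪V, ∇(½|Ω|²)⟫ = ∫⟪Ω,(DΩ)V⟫ = 0`
  have hq1 : ContDiff ℝ 1 fun z => ‖curl V z‖ ^ 2 / 2 := (hΩ1.norm_sq ℝ).div_const 2
  have hG1 : ContDiff ℝ 1 fun y => (‖curl V y‖ ^ 2 / 2) • V y := hq1.smul hV1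
  have hgrad : ∀ y, ⟪V y, gradient (fun z => ‖curl V z‖ ^ 2 / 2) y⟫ =
      ⟪curl V y, fderiv ℝ (curl V) y (V y)⟫ := by
    intro y
    rw [gradient, (hasFDerivAt_half_norm_sq (hΩd y)).fderiv, real_inner_comm,
      InnerProductSpace.toDual_symm_apply, ContinuousLinearMap.comp_apply, innerSL_apply_apply]
  have hdivG : ∀ y, VectorCalculus.divergence (fun z => (‖curl V z‖ ^ 2 / 2) • V z) y =
      ⟪curl V y, fderiv ℝ (curl V) y (V y)⟫ := by
    intro y
    rw [divergence_smul_apply (hq1.differentiable one_ne_zero y) (hVd y), hdiv' y, mul_zero, zero_add,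
      hgrad]
  have hJ : Integrable fun y => ⟪curl V y, fderiv ℝ (curl V) y (V y)⟫ := by
    refine (hΩD.const_mul L).mono' (hΩ1.continuous.inner (cDΩ.clm_apply hV1.continuous)).aestronglyMeasurable
      (Eventually.of_forall fun y => ?_)
    rw [Real.norm_eq_abs]
    calc |⟪curl V y, fderiv ℝ (curl V) y (V y)⟫| ≤ ‖curl V y‖ * ‖fderiv ℝ (curl V) y (V y)‖ :=
          abs_real_inner_le_norm _ _
      _ ≤ ‖curl V y‖ * (‖fderiv ℝ (curl V) y‖ * L) := by
          gcongr
          exact ((fderiv ℝ (curl V) y).le_opNorm _).trans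
            (mul_le_mul_of_nonneg_left (hVb y) (norm_nonneg _))
      _ = L * (‖curl V y‖ * ‖fderiv ℝ (curl V) y‖) := by ring
  have hGi : Integrable fun y => ‖(‖curl V y‖ ^ 2 / 2) • V y‖ / (1 + ‖y‖) := by
    refine (i1.const_mul (L / 2)).mono' ?_ (Eventually.of_forall fun y => ?_)
    · exact (hG1.continuous.norm.div (continuous_const.add continuous_norm)
        fun y => (by positivity : (0 : ℝ) < 1 + ‖y‖).ne').aestronglyMeasurable
    · rw [Real.norm_of_nonneg (by positivity), norm_smul, Real.norm_of_nonneg (by positivity)]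
      refine (div_le_self (by positivity) (by linarith [norm_nonneg y])).trans ?_
      calc ‖curl V y‖ ^ 2 / 2 * ‖V y‖ ≤ ‖curl V y‖ ^ 2 / 2 * L := by gcongr; exact hVb y
        _ = L / 2 * ‖curl V y‖ ^ 2 := by ring
  have hdiG : Integrable fun y => VectorCalculus.divergence (fun z => (‖curl V z‖ ^ 2 / 2) • V z) y := by
    simp_rw [hdivG]; exact hJ
  have hB := PineauVicol2026.integral_divergence_eq_zero_of_integrable_div hG1 hGi hdiG
  simp_rw [hdivG] at hB
  -- (C) the Lamb form pointwise: `⟪V × Ω, curl Ω⟫ = ⟪Ω,(DΩ)V⟫ − ⟪V,(DΩ)Ω⟫`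
  have hLamb : ∀ y, ⟪cross (V y) (curl V y), curl (curl V) y⟫ =
      ⟪curl V y, fderiv ℝ (curl V) y (V y)⟫ - ⟪V y, fderiv ℝ (curl V) y (curl V y)⟫ := by
    intro y
    have e := convect_self_eq_cross_curl_add_gradient (hΩd y)
    rw [convect_apply] at e
    rw [e, inner_add_right, hgrad, inner_cross_left_eq_neg]
    ring
  refine ⟨?_, ?_⟩
  · have e : (fun y => ⟪cross (V y) (curl V y), curl (curl V) y⟫) =
        fun y => ⟪curl V y, fderiv ℝ (curl V) y (V y)⟫ - ⟪V y, fderiv ℝ (curl V) y (curl V y)⟫ :=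
      funext hLamb
    rw [e]
    exact hJ.sub hI
  · simp_rw [hLamb]
    rw [integral_sub hJ hI, hB]
    linarith

/-! ### The slice inequality in the Beltrami-depletion regime -/

/-- **Slice inequality.** For `V ∈ C³(ℝ³; ℝ³)` divergence free in the profile class with
`‖V‖ ≤ K`, `θ > 0`, `β ≤ θ` and the depletion hypothesis
`∫ (‖curl Ω‖² − ⟪curl Ω, Ω⟫²/‖Ω‖²) ≤ β∫‖curl Ω‖²` (`Ω = curl V`):
`S − D_F − ¼E ≤ −¼(1 − θK²)E`, where `S = ∫⟪Ω,(DV)Ω⟫ = ∫⟪V × Ω, curl Ω⟫`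
(`beltrami_stretch_eq`) is bounded pointwise by `beltrami_pointwise` and integrated,
`S ≤ (θK²/4)E + θ⁻¹β∫‖curl Ω‖² ≤ (θK²/4)E + ∫‖curl Ω‖²`, and `D_F = ∫|DΩ|²_F = ∫‖curl Ω‖²` by
the div–curl identity `stub_divCurlProfile` applied to the divergence-free field `Ω`
(`(1+|y|)|Ω| ≤ κL`, `(1+|y|)²‖DΩ‖ ≤ L`). -/
theorem beltrami_slice_le {V : EuclideanSpace ℝ (Fin 3) → EuclideanSpace ℝ (Fin 3)} (hV3 : ContDiff ℝ 3 V)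
    (hdiv : VectorCalculus.IsDivFree V) {L : ℝ} (hL0 : 0 ≤ L)
    (hL : ∀ y, (1 + ‖y‖) * ‖V y‖ ≤ L ∧ (1 + ‖y‖) ^ 2 * ‖fderiv ℝ V y‖ ≤ L ∧
      (1 + ‖y‖) ^ 3 * ‖fderiv ℝ (curl V) y‖ ≤ L ∧ (1 + ‖y‖) ^ 4 * ‖(Δ (curl V)) y‖ ≤ L)
    {β θ K : ℝ} (hθ : 0 < θ) (hβθ : β ≤ θ) (hVK : ∀ y, ‖V y‖ ≤ K)
    (hdep : ∫ y, (‖curl (curl V) y‖ ^ 2 - ⟪curl (curl V) y, curl V y⟫ ^ 2 / ‖curl V y‖ ^ 2) ≤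
      β * ∫ y, ‖curl (curl V) y‖ ^ 2) :
    (∫ y, ⟪curl V y, fderiv ℝ V y (curl V y)⟫) - (∫ y, frobeniusNormSq (fderiv ℝ (curl V) y)) -
        (1 / 4) * ∫ y, ‖curl V y‖ ^ 2 ≤
      -((1 - θ * K ^ 2) / 4) * ∫ y, ‖curl V y‖ ^ 2 := by
  obtain ⟨i1, -, -, -, i5, -⟩ := enstrophy_slice_integrable hV3 hL0 hL
  have hV2 : ContDiff ℝ 2 V := hV3.of_le (by norm_cast)
  have hΩ2 : ContDiff ℝ 2 (curl V) := PineauVicol2026.contDiff_two_curl hV3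
  have hΩ1 : ContDiff ℝ 1 (curl V) := hΩ2.of_le one_le_two
  have hC1 : ContDiff ℝ 1 (curl (curl V)) := contDiff_curl (n := 1) (by exact_mod_cast hΩ2)
  have cΩ : Continuous (curl V) := hΩ1.continuous
  have cC : Continuous (curl (curl V)) := hC1.continuous
  set κ : ℝ := ‖curlCLM‖ with hκ
  have hκ0 : 0 ≤ κ := by rw [hκ]; exact norm_nonneg curlCLM
  have hΩpt : ∀ y, (1 + ‖y‖) ^ 2 * ‖curl V y‖ ≤ κ * L := fun y => (enstrophy_pointwise hL0 hL y).1
  -- `‖curl Ω‖²` and the depletion integrand are integrable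
  have hiC : Integrable fun y => ‖curl (curl V) y‖ ^ 2 := by
    refine (i5.const_mul (κ ^ 2)).mono' (cC.norm.pow 2).aestronglyMeasurable
      (Eventually.of_forall fun y => ?_)
    rw [Real.norm_of_nonneg (sq_nonneg _)]
    calc ‖curl (curl V) y‖ ^ 2 ≤ (κ * ‖fderiv ℝ (curl V) y‖) ^ 2 :=
          pow_le_pow_left₀ (norm_nonneg _) (norm_curl_le (curl V) y) 2
      _ = κ ^ 2 * ‖fderiv ℝ (curl V) y‖ ^ 2 := by ring
  have hdnn : ∀ y, 0 ≤ ⟪curl (curl V) y, curl V y⟫ ^ 2 / ‖curl V y‖ ^ 2 := fun y => by positivity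
  have hdle : ∀ y, ⟪curl (curl V) y, curl V y⟫ ^ 2 / ‖curl V y‖ ^ 2 ≤ ‖curl (curl V) y‖ ^ 2 := by
    intro y
    refine div_le_of_le_mul₀ (sq_nonneg _) (sq_nonneg _) ?_
    have h := pow_le_pow_left₀ (abs_nonneg _) (abs_real_inner_le_norm (curl (curl V) y) (curl V y)) 2
    rwa [sq_abs, mul_pow] at h
  have hid : Integrable fun y =>
      ‖curl (curl V) y‖ ^ 2 - ⟪curl (curl V) y, curl V y⟫ ^ 2 / ‖curl V y‖ ^ 2 := by
    refine hiC.mono' ?_ (Eventually.of_forall fun y => ?_)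
    · exact ((cC.norm.pow 2).measurable.sub
        (((cC.inner cΩ).pow 2).measurable.div (cΩ.norm.pow 2).measurable)).aestronglyMeasurable
    · rw [Real.norm_of_nonneg (sub_nonneg.2 (hdle y))]
      linarith [hdnn y]
  -- the Lamb form of the stretching integral and the pointwise depletion bound, integrated
  obtain ⟨hiX, hS⟩ := beltrami_stretch_eq hV3 hdiv hL0 hL
  have hX : (∫ y, ⟪cross (V y) (curl V y), curl (curl V) y⟫) ≤
      θ * K ^ 2 / 4 * (∫ y, ‖curl V y‖ ^ 2) +
        θ⁻¹ * ∫ y, (‖curl (curl V) y‖ ^ 2 - ⟪curl (curl V) y, curl V y⟫ ^ 2 / ‖curl V y‖ ^ 2) := by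
    rw [← integral_const_mul, ← integral_const_mul, ← integral_add (i1.const_mul _) (hid.const_mul _)]
    exact integral_mono hiX ((i1.const_mul _).add (hid.const_mul _)) fun y =>
      beltrami_pointwise (V y) (curl V y) (curl (curl V) y) (hVK y) hθ
  -- the dissipation is `∫‖curl Ω‖²` (div–curl identity for the divergence-free field `Ω`)
  have hdivΩ : VectorCalculus.IsDivFree (curl V) := fun y => divergence_curl_eq_zero_holds V hV2 y
  have hdecΩ : ∀ y, (1 + ‖y‖) * ‖curl V y‖ ≤ κ * L + L ∧
      (1 + ‖y‖) ^ 2 * ‖fderiv ℝ (curl V) y‖ ≤ κ * L + L := by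
    intro y
    have hr1 : (1 : ℝ) ≤ 1 + ‖y‖ := by linarith [norm_nonneg y]
    have hκL : 0 ≤ κ * L := mul_nonneg hκ0 hL0
    refine ⟨?_, ?_⟩
    · calc (1 + ‖y‖) * ‖curl V y‖ ≤ (1 + ‖y‖) ^ 2 * ‖curl V y‖ :=
            mul_le_mul_of_nonneg_right (by nlinarith) (norm_nonneg _)
        _ ≤ κ * L := hΩpt y
        _ ≤ κ * L + L := by linarith
    · calc (1 + ‖y‖) ^ 2 * ‖fderiv ℝ (curl V) y‖ ≤ (1 + ‖y‖) ^ 3 * ‖fderiv ℝ (curl V) y‖ :=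
            mul_le_mul_of_nonneg_right (pow_le_pow_right₀ hr1 (by norm_num)) (norm_nonneg _)
        _ ≤ L := (hL y).2.2.1
        _ ≤ κ * L + L := by linarith
  have hD : ∫ y, frobeniusNormSq (fderiv ℝ (curl V) y) = ∫ y, ‖curl (curl V) y‖ ^ 2 :=
    (stub_divCurlProfile (curl V) (κ * L + L) hΩ2 hdecΩ hdivΩ).2
  have hDnn : 0 ≤ ∫ y, ‖curl (curl V) y‖ ^ 2 := integral_nonneg fun y => sq_nonneg _
  have h3 : θ⁻¹ * ∫ y, (‖curl (curl V) y‖ ^ 2 - ⟪curl (curl V) y, curl V y⟫ ^ 2 / ‖curl V y‖ ^ 2) ≤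
      ∫ y, ‖curl (curl V) y‖ ^ 2 := by
    calc θ⁻¹ * ∫ y, (‖curl (curl V) y‖ ^ 2 - ⟪curl (curl V) y, curl V y⟫ ^ 2 / ‖curl V y‖ ^ 2)
        ≤ θ⁻¹ * (β * ∫ y, ‖curl (curl V) y‖ ^ 2) := mul_le_mul_of_nonneg_left hdep (inv_nonneg.2 hθ.le)
      _ = (β / θ) * ∫ y, ‖curl (curl V) y‖ ^ 2 := by ring
      _ ≤ 1 * ∫ y, ‖curl (curl V) y‖ ^ 2 :=
          mul_le_mul_of_nonneg_right (div_le_one_of_le₀ hβθ hθ.le) hDnn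
      _ = ∫ y, ‖curl (curl V) y‖ ^ 2 := one_mul _
  have e : -((1 - θ * K ^ 2) / 4) * ∫ y, ‖curl V y‖ ^ 2 =
      θ * K ^ 2 / 4 * (∫ y, ‖curl V y‖ ^ 2) - (1 / 4) * ∫ y, ‖curl V y‖ ^ 2 := by ring
  rw [e, hS, hD]
  linarith

/-! ### The stub -/

/-- **The Beltrami-depletion regime** (registered sub-goal `stub_beltramiRegime` of crux
stmt-NavierStokesRegularity-1934, line `registered`, v19). An eternal classical solution `(W, Q)`
of Leray's backward system on `ℝ × ℝ³` in the uniform profile class with amplitude `‖W‖ ≤ K`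
whose vorticity `Ω = curl W` has, on every slice, a depleted non-Beltrami part of its curl,
`∫ (‖curl Ω‖² − ⟪curl Ω, Ω⟫²/‖Ω‖²) ≤ β ∫‖curl Ω‖²` with `0 ≤ β`, `βK² < 1`, vanishes identically.
Choose `θ = β + (1 − βK²)/(2(K² + 1)) > 0`, `θ ≥ β`, `θK² < 1`; the slice inequality
`S − D_F − ¼E ≤ −¼(1 − θK²)E` (`beltrami_slice_le`) and the enstrophy identity
`E(s₁) − E(s₀) = 2∫(S − D_F − ¼E)` (`stub_enstrophyEvolution`) give
`E(s₁) − E(s₀) ≤ −½(1 − θK²)∫E`; the backward Grönwall lemma (`stub_backwardGronwall`) kills the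
bounded enstrophy, the continuous integrand `‖curl W(s)‖²` vanishes
(`backusRegime_eq_zero_of_integral_sq_norm_eq_zero`), and `stub_curlFreeLiouville` finishes. -/
theorem stub_beltramiRegime :
    ∀ (W : ℝ → EuclideanSpace ℝ (Fin 3) → EuclideanSpace ℝ (Fin 3)) (Q : ℝ → EuclideanSpace ℝ (Fin 3) → ℝ),
      IsBackwardLeraySolutionOn univ 1 W Q →
      (∀ k : ℕ, ∃ K : ℝ, ∀ s y, (1 + ‖y‖) ^ (k + 1) * ‖iteratedFDeriv ℝ k (W s) y‖ ≤ K) →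
      (∃ β K : ℝ, 0 ≤ β ∧ β * K ^ 2 < 1 ∧ (∀ s y, ‖W s y‖ ≤ K) ∧
        ∀ s, ∫ y, (‖curl (curl (W s)) y‖ ^ 2 -
            ⟪curl (curl (W s)) y, curl (W s) y⟫ ^ 2 / ‖curl (W s) y‖ ^ 2) ≤
          β * ∫ y, ‖curl (curl (W s)) y‖ ^ 2) →
      ∀ s y, W s y = 0 := by
  intro W Q h hdec hβ
  obtain ⟨β, K, hβ0, hβK, hWK, hdep⟩ := hβ
  -- a positive depletion constant `θ ≥ β` with `θK² < 1`
  obtain ⟨θ, hθ0, hβθ, hθK⟩ : ∃ θ : ℝ, 0 < θ ∧ β ≤ θ ∧ θ * K ^ 2 < 1 := by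
    have hK2 : (0 : ℝ) < K ^ 2 + 1 := by positivity
    have hgap : 0 < 1 - β * K ^ 2 := by linarith
    have hinc : 0 < (1 - β * K ^ 2) / (2 * (K ^ 2 + 1)) := by positivity
    refine ⟨β + (1 - β * K ^ 2) / (2 * (K ^ 2 + 1)), by linarith, by linarith, ?_⟩
    have e : 1 - (β + (1 - β * K ^ 2) / (2 * (K ^ 2 + 1))) * K ^ 2 =
        (1 - β * K ^ 2) * (K ^ 2 + 2) / (2 * (K ^ 2 + 1)) := by
      field_simp
      ring
    have hpos : 0 < (1 - β * K ^ 2) * (K ^ 2 + 2) / (2 * (K ^ 2 + 1)) := by positivity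
    linarith
  have hsm : IsSmoothSpaceTimeOn univ W := h.smooth_velocity
  have hW3 : ∀ s, ContDiff ℝ 3 (W s) := fun s => (hsm.contDiff_slice (mem_univ s)).of_le (by norm_cast)
  obtain ⟨L, hL0, hL⟩ := enstrophy_decay hW3 hdec
  obtain ⟨hint, ⟨M, hM⟩, ⟨B, hB⟩, hId⟩ := stub_enstrophyEvolution W Q h hdec
  -- the enstrophy is continuous (Lipschitz) in `s`
  have hEc : Continuous fun s => ∫ y, ‖curl (W s) y‖ ^ 2 := by
    refine (LipschitzWith.of_le_add_mul' (f := fun s => ∫ y, ‖curl (W s) y‖ ^ 2) B fun s s' => ?_).continuous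
    rw [Real.dist_eq]
    linarith [hB s' s, le_abs_self ((∫ y, ‖curl (W s) y‖ ^ 2) - ∫ y, ‖curl (W s') y‖ ^ 2)]
  -- the slice inequality `S − D_F − ¼E ≤ −¼(1 − θK²)E`
  have hslice : ∀ s, (∫ y, ⟪curl (W s) y, fderiv ℝ (W s) y (curl (W s) y)⟫) -
      (∫ y, frobeniusNormSq (fderiv ℝ (curl (W s)) y)) - (1 / 4) * ∫ y, ‖curl (W s) y‖ ^ 2 ≤
      -((1 - θ * K ^ 2) / 4) * ∫ y, ‖curl (W s) y‖ ^ 2 := fun s =>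
    beltrami_slice_le (hW3 s) (h.divFree s (mem_univ s)) hL0 (hL s) hθ0 hβθ (hWK s) (hdep s)
  -- the increment inequality and the backward Grönwall lemma
  have hc : 0 < 2 * ((1 - θ * K ^ 2) / 4) := by linarith
  have hincr : ∀ s₀ s₁ : ℝ, s₀ ≤ s₁ →
      (∫ y, ‖curl (W s₁) y‖ ^ 2) - (∫ y, ‖curl (W s₀) y‖ ^ 2) ≤
        -(2 * ((1 - θ * K ^ 2) / 4)) * ∫ s in s₀..s₁, (∫ y, ‖curl (W s) y‖ ^ 2) := by
    intro s₀ s₁ hle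
    obtain ⟨hI, hId'⟩ := hId s₀ s₁ hle
    have hmono := intervalIntegral.integral_mono_on hle hI
      (((hEc.intervalIntegrable s₀ s₁).const_mul (-((1 - θ * K ^ 2) / 4)))) fun s _ => hslice s
    rw [intervalIntegral.integral_const_mul] at hmono
    linarith
  have hE : ∀ s, (∫ y, ‖curl (W s) y‖ ^ 2) = 0 :=
    stub_backwardGronwall (fun s => ∫ y, ‖curl (W s) y‖ ^ 2) (2 * ((1 - θ * K ^ 2) / 4)) M hc
      (fun s => integral_nonneg fun y => sq_nonneg _) hM hincr
  -- hence the vorticity vanishes, and the curl-free Liouville theorem finishes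
  have hcurl : ∀ s y, curl (W s) y = 0 := fun s =>
    backusRegime_eq_zero_of_integral_sq_norm_eq_zero (PineauVicol2026.contDiff_two_curl (hW3 s)).continuous
      (hint s) (hE s)
  exact stub_curlFreeLiouville W Q h hdec hcurl

end Summit.NavierStokesRegularity.NavierStokesRegularity.Theorems.NoSelfExcitedDynamo.Registered

end
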